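import Mathlib.MeasureTheory.Integral.IntervalIntegral.Basic
import Mathlib.MeasureTheory.Integral.Bochner.Set
import Mathlib.MeasureTheory.Function.SpecialFunctions.Basic
import HarnessLib

/-!
# An integral Gronwall lemma with zero data, almost-everywhere version

If `F ≥ 0` is integrable on `(0,T)` and `F(τ) ≤ K ∫_{(0,τ)} F` for a.e. `τ ∈ (0,T)`, then `F = 0`
a.e. on `(0,T)`. The proof avoids differentiation: `H(τ) = ∫_{(0,τ)} F` is non-decreasing, and on
any window of length `≤ 1/(2K+2)` starting at a zero of `H` one gets `H ≤ H/2`; finitely many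
windows cover `[0,T]`. This is the form of Gronwall's lemma used at the end of BF §3.2.2
(`𝓔_Z(0) = 0 ⟹ 𝓔_Z ≡ 0, D ≡ 0`).

## References

* J. Březina, E. Feireisl, J. Math. Soc. Japan 70 (2018), end of §3.2.2. [folklore]
-/

noncomputable section

open Set MeasureTheory Filter
open scoped Topology

namespace Literature.Analysis.FluidPDE

namespace CompressibleEuler

/-- **Integral Gronwall inequality with zero data** (a.e. form): `0 ≤ F ∈ L¹(0,T)` and
`F(τ) ≤ K ∫_{(0,τ)} F` for a.e. `τ` force `F = 0` a.e. on `(0,T)`. [folklore] -/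
theorem ae_eq_zero_of_le_integral {F : ℝ → ℝ} {T K : ℝ} (hK : 0 ≤ K)
    (hFi : IntegrableOn F (Ioo 0 T) volume) (hF0 : ∀ᵐ t ∂(volume.restrict (Ioo 0 T)), 0 ≤ F t)
    (hineq : ∀ᵐ τ ∂(volume.restrict (Ioo 0 T)), F τ ≤ K * ∫ t in Ioo 0 τ, F t) :
    ∀ᵐ t ∂(volume.restrict (Ioo 0 T)), F t = 0 := by
  -- the primitive
  set H : ℝ → ℝ := fun τ => ∫ t in Ioo 0 τ, F t with hH
  have hF0' : ∀ᵐ t ∂volume, t ∈ Ioo 0 T → 0 ≤ F t := (ae_restrict_iff' measurableSet_Ioo).1 hF0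
  have hineq' : ∀ᵐ τ ∂volume, τ ∈ Ioo 0 T → F τ ≤ K * H τ := (ae_restrict_iff' measurableSet_Ioo).1 hineq
  -- integrals over sub-intervals of `(0,T)`
  have hsub : ∀ {σ τ : ℝ}, 0 ≤ σ → τ ≤ T → Ioo σ τ ⊆ Ioo 0 T := fun hσ hτ t ht =>
    ⟨hσ.trans_lt ht.1, ht.2.trans_le hτ⟩
  have hint : ∀ {σ τ : ℝ}, 0 ≤ σ → τ ≤ T → IntegrableOn F (Ioo σ τ) volume := fun hσ hτ =>
    hFi.mono_set (hsub hσ hτ)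
  have hnn : ∀ {σ τ : ℝ}, 0 ≤ σ → τ ≤ T → 0 ≤ ∫ t in Ioo σ τ, F t := fun hσ hτ =>
    setIntegral_nonneg_ae measurableSet_Ioo (hF0'.mono fun t ht ht' => ht (hsub hσ hτ ht'))
  -- `H` is non-decreasing on `[0,T]` and splits over sub-intervals
  have hIoo : ∀ {σ τ : ℝ}, σ ≤ τ → ∫ t in Ioo σ τ, F t = ∫ t in σ..τ, F t := fun hστ => by
    rw [intervalIntegral.integral_of_le hστ, integral_Ioc_eq_integral_Ioo]
  have hII : ∀ {σ τ : ℝ}, 0 ≤ σ → σ ≤ τ → τ ≤ T → IntervalIntegrable F volume σ τ := fun hσ hστ hτ =>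
    (intervalIntegrable_iff_integrableOn_Ioo_of_le hστ).2 (hint hσ hτ)
  have hsplit : ∀ {σ τ : ℝ}, 0 ≤ σ → σ ≤ τ → τ ≤ T → H τ = H σ + ∫ t in Ioo σ τ, F t := by
    intro σ τ hσ hστ hτ
    simp only [hH]
    rw [hIoo (hσ.trans hστ), hIoo hσ, hIoo hστ,
      intervalIntegral.integral_add_adjacent_intervals (hII le_rfl hσ (hστ.trans hτ)) (hII hσ hστ hτ)]
  have hmono : ∀ {σ τ : ℝ}, 0 ≤ σ → σ ≤ τ → τ ≤ T → H σ ≤ H τ := fun hσ hστ hτ => by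
    rw [hsplit hσ hστ hτ]; linarith [hnn hσ hτ]
  have hH0 : H 0 = 0 := by simp [hH]
  have hHnn : ∀ {τ : ℝ}, 0 ≤ τ → τ ≤ T → 0 ≤ H τ := fun hτ hτ' => by
    have := hmono le_rfl hτ hτ'; rwa [hH0] at this
  -- the window estimate: `H τ - H σ ≤ K (τ - σ) H τ`
  have hwin : ∀ {σ τ : ℝ}, 0 ≤ σ → σ ≤ τ → τ ≤ T → H τ - H σ ≤ K * (τ - σ) * H τ := by
    intro σ τ hσ hστ hτ
    have e := hsplit hσ hστ hτ
    have hb : ∀ᵐ t ∂volume, t ∈ Ioo σ τ → F t ≤ K * H τ := by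
      filter_upwards [hineq'] with t ht ht'
      have htT : t ∈ Ioo 0 T := hsub hσ hτ ht'
      exact (ht htT).trans (mul_le_mul_of_nonneg_left (hmono (hσ.trans ht'.1.le) ht'.2.le hτ) hK)
    have hc : ∫ t in Ioo σ τ, F t ≤ K * (τ - σ) * H τ :=
      calc ∫ t in Ioo σ τ, F t ≤ ∫ _t in Ioo σ τ, K * H τ :=
            setIntegral_mono_on_ae (hint hσ hτ) (by
              refine integrableOn_const ?_
              exact ne_of_lt measure_Ioo_lt_top) measurableSet_Ioo hb
        _ = K * (τ - σ) * H τ := by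
            rw [setIntegral_const, Real.volume_real_Ioo_of_le hστ, smul_eq_mul]; ring
    linarith
  -- induction over windows of length `h₀ = 1/(2K+2)`
  set h₀ : ℝ := 1 / (2 * K + 2) with hh₀
  have hh₀pos : 0 < h₀ := by rw [hh₀]; positivity
  have hKh₀ : K * h₀ ≤ 1 / 2 := by
    rw [hh₀, mul_one_div, div_le_iff₀ (by positivity)]; linarith
  have hstep : ∀ n : ℕ, ∀ τ, 0 ≤ τ → τ ≤ T → τ ≤ n * h₀ → H τ = 0 := by
    intro n
    induction n with
    | zero =>
      intro τ hτ0 _ hτn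
      simp only [Nat.cast_zero, zero_mul] at hτn
      rw [le_antisymm hτn hτ0, hH0]
    | succ n ih =>
      intro τ hτ0 hτT hτn
      set σ := max (τ - h₀) 0 with hσ
      have hσ0 : 0 ≤ σ := le_max_right _ _
      have hστ : σ ≤ τ := max_le (by linarith) hτ0
      have hσn : σ ≤ n * h₀ := by
        refine max_le ?_ (by positivity)
        have : ((n + 1 : ℕ) : ℝ) * h₀ = n * h₀ + h₀ := by push_cast; ring
        linarith
      have hHσ : H σ = 0 := ih σ hσ0 (hστ.trans hτT) hσn
      have hτσ : τ - σ ≤ h₀ := by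
        have : τ - h₀ ≤ σ := le_max_left _ _
        linarith
      have h1 := hwin hσ0 hστ hτT
      rw [hHσ, sub_zero] at h1
      have hHτ := hHnn hτ0 hτT
      have h2 : K * (τ - σ) * H τ ≤ 1 / 2 * H τ := by
        refine mul_le_mul_of_nonneg_right ?_ hHτ
        calc K * (τ - σ) ≤ K * h₀ := mul_le_mul_of_nonneg_left hτσ hK
          _ ≤ 1 / 2 := hKh₀
      linarith
  -- `H T = 0`
  by_cases hT : 0 < T
  · obtain ⟨n, hn⟩ := exists_nat_ge (T / h₀)
    have hHT : H T = 0 := hstep n T hT.le le_rfl (by rwa [div_le_iff₀ hh₀pos] at hn)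
    have := (integral_eq_zero_iff_of_nonneg_ae hF0 hFi).1 hHT
    exact this
  · have : Ioo (0 : ℝ) T = ∅ := Ioo_eq_empty hT
    rw [this, Measure.restrict_empty, ae_zero]
    exact Filter.eventually_bot

end CompressibleEuler

end Literature.Analysis.FluidPDE
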